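import Literature.Probability.RandomPlanarGeometry.ConformalRestrictionLoewner
import Literature.Probability.RandomPlanarGeometry.LoewnerSlitTheorem
import HarnessLib

/-!
# [LSW] Proposition 3.3, (1) ⇒ (3): the discharge

G. F. Lawler, O. Schramm, W. Werner, *Conformal restriction: the chordal case*, J. Amer. Math.
Soc. **16** (2003) 917–955, arXiv:math/0209343 (**[LSW]**, arXiv page numbers), Prop. 3.3
(pp. 10–11) with its proof (pp. 11–13, Lemma 3.5).

Proof-only file (no new definition, no new named fact). It discharges the named fact
`Literature.Probability.RandomPlanarGeometry.exists_isRestrictionMeasure_of_isHullMultiplicative`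
of `RestrictionMeasures` — a probability measure on `Ω` which is `Γ`-invariant and
`𝒜₁`-covariant (homomorphism form: `RestrictionConfig.IsScaleInvariant`,
`RestrictionConfig.IsHullMultiplicative`) is the two-sided restriction measure `P_α` for some
`α > 0` — by composing two theorems of the tree:

* `exists_isRestrictionMeasure_of_isHullMultiplicative_of_loewner` (`ConformalRestrictionLoewner`):
  Prop. 3.3 (1) ⇒ (3) relative to Loewner's slit theorem for the boundary path of an arc hull
  (`IsArcHull.exists_loewner_chain`), assembling `RestrictionExponent` (the printed proof
  pp. 11–13 from the two clauses of Lemma 3.5: the Loewner semigroup `G_t`, `F(G_t) = e^{-2αt}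
  = G_t'(0)^α`, scale invariance, `α₋ = α`, `A = A₊ · A₋`, `α > 0`), `RestrictionContinuityProofs`
  (Lemma 3.5, continuity of `F`) and `RestrictionDensityLoewner` (Lemma 3.5, density of `𝒜₀` in
  `𝒬₊`, from Loewner's theorem by the Euler scheme of `LoewnerEulerScheme`);
* `IsArcHull.exists_loewner_chain_holds` (`LoewnerSlitTheorem`): that slit theorem, proved
  ([LSW] p. 13 "By the chordal version of Loewner's theorem"; Lawler (2005), Prop. 4.4).

The discharge cannot sit in `RestrictionMeasures.lean` or `RestrictionMeasuresProofs.lean`: both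
are imported (transitively) by `ConformalRestrictionLoewner`, so appending there would close an
import cycle; hence this sibling file.

## References

* G. F. Lawler, O. Schramm, W. Werner, *Conformal restriction: the chordal case*, J. Amer. Math.
  Soc. **16** (2003), arXiv:math/0209343: Prop. 3.3 (pp. 10–11), Lemma 3.5 (pp. 12–13).
  [LawlerSchrammWerner2003Restriction]
* G. F. Lawler, *Conformally Invariant Processes in the Plane*, AMS (2005), §4.1, Prop. 4.4.
  [Lawler2005]
-/

noncomputable section

namespace Literature.Probability.RandomPlanarGeometry

/-- **[LSW] Proposition 3.3, (1) ⇒ (3)** (pp. 10–11; proof pp. 11–13): "For any probability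
measure `P` on `Ω` … (1) `P` is `Γ`-invariant and `𝒜₁`-covariant" implies "(3) there exists an
`α > 0` such that for all `A ∈ 𝒬*`, `P[K ∩ A = ∅] = Φ_A'(0)^α`" — the named fact
`exists_isRestrictionMeasure_of_isHullMultiplicative` HOLDS. Proof: the tree's reduction to
Loewner's slit theorem (`exists_isRestrictionMeasure_of_isHullMultiplicative_of_loewner`) fed with
the tree's proof of that theorem (`IsArcHull.exists_loewner_chain_holds`).
[cite: LawlerSchrammWerner2003Restriction, Prop. 3.3 (1) ⇒ (3) (pp. 10–13)] -/
theorem exists_isRestrictionMeasure_of_isHullMultiplicative_holds :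
    exists_isRestrictionMeasure_of_isHullMultiplicative :=
  exists_isRestrictionMeasure_of_isHullMultiplicative_of_loewner IsArcHull.exists_loewner_chain_holds

end Literature.Probability.RandomPlanarGeometry

end
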